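import Summits.HodgeConjecture.HodgeConjecture.Theorems.F0P3cPKtupleHSideLetters   -- ★ `Realises₁`, `IsFinConstituentAt₁` (LH7-p03 (g2), p849785)
import Literature.NumberTheory.Automorphic.AutomorphicCharacterLine                   -- ★ `DiscreteAutomorphicRep.ofChar`, `exists_eq_ofChar_adelicGroupData_one`
import Literature.NumberTheory.Automorphic.CharacterLineFinConstituents               -- ★ finite constituents of a character line, scalar constituents
import Literature.NumberTheory.Automorphic.UnitaryGroupDetCharacter                   -- ★ `cmDetChar`, `detChar_comp_inclPlaceAdelic`, `cm_eq_of_forall_comp_inclPlaceAdelic_eq_of_one`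
import Literature.NumberTheory.Automorphic.IrreducibleClassesComap                    -- ★ `IrrClass.comap`, `comap_injective`
import HarnessLib

/-!
# LH7 (γ′) «THE `U(1)` LINE» — the discrete automorphic representation of `U(Φ₁)` realising `ξ_v ∘ inr = ψ_v ∘ det`: existence, uniqueness,
# and «an occurring character family equal to `ψ_v` almost everywhere is `ψ_v` everywhere» ([Rogawski1990] §13.3 p. 203, `m(ξ) = 1` on the `U(1)`-factor)

Cell `hodgecm-mathlib` (D-0151), crux H413 = `stmt-HodgeConjecture-24833`, line LH7 (closer row `stub_PKtupleK2`), banked road «leaf ED. 3, H-SIDE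
CONSTRUCTION ROWS» (LH7-plan (g2) `MEMO-ED3.v2` §3 (γ′); LH7-plan (g3) D64′; statement layer ★ p849785 `Theorems/F0P3cPKtupleHSideLetters`).
THEOREMS ONLY (kernel lane): no `def`, no instance, no notation, no named fact, no `sorry`.  HONEST LABEL: count-neutral in-house glue for the
`U(1)`-factor of the derived rows (KR-2) ∕ (PK-A-H♭) of O1′; HC_CM is proved only modulo the printed citations until rung 0 closes.

THE MATHEMATICS.  `U(Φ₁) = U(1)_{L/L⁺}` is a COMMUTATIVE adelic datum, so (★ `AutomorphicCharacterLine`) its discrete automorphic representations are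
exactly the lines `ofChar θ μ₁` of its unitary automorphic characters `θ` (`R(g) = θ(g)⁻¹` on the line), and (★ `UnitaryGroupDetCharacter`, `N = 1`)
every such `θ` is `ψ₀ ∘ det` for an automorphic character `ψ₀` of the norm-one torus, determined by its restrictions to the `U(Φ₁)(L⁺_v)` off any finite set
(Tate's density).  By ★ `CharacterLineFinConstituents` the finite constituents of the line of `θ` at `v` are `{⟦θ⁻¹ ∘ ι_v⟧}`, and by ★
`detChar_comp_inclPlaceAdelic` `(ψ ∘ det) ∘ ι_v = ψ_v ∘ det ∘ (localPiEquiv v)`; since `ξ_v ∘ inr = ψ_v ∘ det` (★ `xiLocalChar_apply_eq`):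

* `realises₁_iff_eq_ofChar` — **`Realises₁ P₁ ξ ↔ P₁ = ofChar (ψ ∘ det)⁻¹ μ₁`** (`ψ = ξ.ψ`); hence `realises₁_ofChar`, `exists_realises₁`,
  `realises₁_unique`, `existsUnique_realises₁` — the `P₁`-clauses of the leaf row (KD5-H♭) DISCHARGED;
* `forall_eq_of_cmOccursInDiscreteSpectrum_of_eventually_eq` — a character family `χ₁` of the `U(Φ₁)(L⁺_v)` OCCURRING in `L²_disc(U(Φ₁), μ₁)`
  (★ `cmOccursInDiscreteSpectrum`, `N = 1`) with `χ₁ v = ξ_v ∘ inr` for all but finitely many `v` satisfies it for EVERY `v` — the `U(1)` half of the glue O6.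

## References
* [Rogawski1990] J. D. Rogawski, *Automorphic Representations of Unitary Groups in Three Variables* (1990), §13.3 pp. 202–203 (`ξ(h) = η(det₀ h)ψ(det h)`,
  `n(ξ) = m(ξ) = 1`), §12.2 pp. 173–174.
* [Gelbart1975] S. Gelbart, *Automorphic forms on adele groups* (1975), §2.A, Thm. 10.10 (multiplicity one for characters).
* [CasselsFrohlichANT1967] Ch. VII (Tate) §4 Prop. 4.1 (density of `E^× 𝕀_E^S`).
-/

set_option autoImplicit false
-- the mandated namespace repeats the single-problem summit's segment (`HodgeConjecture.HodgeConjecture`)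
set_option linter.dupNamespace false

noncomputable section

namespace Summit.HodgeConjecture.HodgeConjecture.Cruxes.H413.F0P3cPKtupleU1Line

open MeasureTheory NumberField IsDedekindDomain
open Literature.NumberTheory.Automorphic Literature.NumberTheory.Automorphic.UnitaryGroup
open Literature.NumberTheory.Rogawski1990 Literature.NumberTheory.GaloisRepresentations
open Literature.NumberTheory.Automorphic.Arthur2013.Leaves.TECR
open Summit.HodgeConjecture.HodgeConjecture.Cruxes.H413.F0P3GlobalPacketDiscrete
open Summit.HodgeConjecture.HodgeConjecture.Cruxes.H413.F0P3cPKtupleHSideLetters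

universe u

variable {L : Type} [Field L] [NumberField L] [IsCMField L]

/-! ## §0 Two generic helpers -/

/-- `comap e ⟦ℂ_χ⟧ = ⟦ℂ_(χ ∘ e)⟧` for an isomorphism of topological groups `e` (the identity of `ℂ` intertwines). [cite: BushnellHenniart2006, §1.1] -/
theorem comap_mk_ofChar {G G' : Type u} [Group G] [TopologicalSpace G] [IsTopologicalGroup G] [Group G'] [TopologicalSpace G'] [IsTopologicalGroup G']
    (e : G' ≃ₜ* G) (χ : G →* ℂˣ) (hχ : IsOpen ((χ.ker : Subgroup G) : Set G))
    (hχe : IsOpen (((χ.comp e.toMonoidHom).ker : Subgroup G') : Set G')) :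
    IrrClass.comap e (IrrClass.mk (SmoothIrrep.ofChar χ hχ)) = IrrClass.mk (SmoothIrrep.ofChar (χ.comp e.toMonoidHom) hχe) := by
  rw [IrrClass.comap_mk]
  refine IrrClass.mk_eq_mk_of_equiv (Representation.Equiv.mk (LinearEquiv.refl ℂ ℂ) fun g => LinearMap.ext fun z => ?_)
  change (SmoothIrrep.ofChar χ hχ).ρ (e g) z = (SmoothIrrep.ofChar (χ.comp e.toMonoidHom) hχe).ρ g z
  rw [SmoothIrrep.ofChar_ρ_apply, SmoothIrrep.ofChar_ρ_apply]
  rfl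

/-- The open kernel of `χ ∘ e` from that of `χ`. [cite: BushnellHenniart2006, §1.1] -/
theorem isOpen_ker_comp_equiv {G G' : Type u} [Group G] [TopologicalSpace G] [Group G'] [TopologicalSpace G'] (e : G' ≃ₜ* G) (χ : G →* ℂˣ)
    (hχ : IsOpen ((χ.ker : Subgroup G) : Set G)) : IsOpen (((χ.comp e.toMonoidHom).ker : Subgroup G') : Set G') :=
  hχ.preimage e.continuous

/-! ## §1 `ξ_v ∘ inr = ψ_v ∘ det` on `U(Φ₁)(L⁺_v)`, and `= (ψ ∘ det) ∘ ι_v` through the Π-model -/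

/-- The open kernel of `ξ_v ∘ inr` (★ `isOpen_ker_xiLocalChar`, pulled back along `u ↦ (1, u)`), in the `Subgroup`-coercion spelling. [cite: Rogawski1990, §12.1 p. 171] -/
theorem isOpen_ker_xiLocalChar_comp_inr (ξ : OneDimAutRepH L) (v : HeightOneSpectrum (𝓞 ↥(maximalRealSubfield L))) :
    IsOpen ((((ξ.xiLocalChar v).comp (MonoidHom.inr ((cmDatum L 2 (Matrix.of fun i j : Fin 2 => if i.val + j.val + 1 = 2 then (1 : L) else 0)).Local v) ((cmDatum L 1 (Matrix.of fun i j : Fin 1 => if i.val + j.val + 1 = 1 then (1 : L) else 0)).Local v))).ker : Subgroup ((cmDatum L 1 (Matrix.of fun i j : Fin 1 => if i.val + j.val + 1 = 1 then (1 : L) else 0)).Local v)) : Set ((cmDatum L 1 (Matrix.of fun i j : Fin 1 => if i.val + j.val + 1 = 1 then (1 : L) else 0)).Local v)) :=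
  ((F0P3XiLocalCharOpenKernel.isOpen_ker_xiLocalChar L ξ v).preimage (Continuous.prodMk_right 1))

/-- **`ξ_v ∘ inr = ψ_v ∘ det`** on the `U(Φ₁)`-factor (`η_v(det₀ 1) = 1`; ★ `xiLocalChar_apply_eq`). [cite: Rogawski1990, §13.3 p. 202] -/
theorem xiLocalChar_comp_inr (ξ : OneDimAutRepH L) (v : HeightOneSpectrum (𝓞 ↥(maximalRealSubfield L))) :
    ((ξ.xiLocalChar v).comp (MonoidHom.inr ((cmDatum L 2 (Matrix.of fun i j : Fin 2 => if i.val + j.val + 1 = 2 then (1 : L) else 0)).Local v) ((cmDatum L 1 (Matrix.of fun i j : Fin 1 => if i.val + j.val + 1 = 1 then (1 : L) else 0)).Local v))) =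
      (torusLocalComponent L (IsCMField.complexConj L) v ξ.ψ).comp (localDet (IsCMField.complexConj L) v (isUnit_antidiagOne_det L 1)) := by
  refine MonoidHom.ext fun u => ?_
  have e1 : localDet (IsCMField.complexConj L) v (isUnit_antidiagOne_det L 2) (MonoidHom.inr ((cmDatum L 2 (Matrix.of fun i j : Fin 2 => if i.val + j.val + 1 = 2 then (1 : L) else 0)).Local v) ((cmDatum L 1 (Matrix.of fun i j : Fin 1 => if i.val + j.val + 1 = 1 then (1 : L) else 0)).Local v) u).1 = 1 :=
    map_one (localDet (IsCMField.complexConj L) v (isUnit_antidiagOne_det L 2))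
  calc ((ξ.xiLocalChar v).comp (MonoidHom.inr ((cmDatum L 2 (Matrix.of fun i j : Fin 2 => if i.val + j.val + 1 = 2 then (1 : L) else 0)).Local v) ((cmDatum L 1 (Matrix.of fun i j : Fin 1 => if i.val + j.val + 1 = 1 then (1 : L) else 0)).Local v))) u
        = ξ.xiLocalChar v (MonoidHom.inr ((cmDatum L 2 (Matrix.of fun i j : Fin 2 => if i.val + j.val + 1 = 2 then (1 : L) else 0)).Local v) ((cmDatum L 1 (Matrix.of fun i j : Fin 1 => if i.val + j.val + 1 = 1 then (1 : L) else 0)).Local v) u) := rfl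
    _ = torusLocalComponent L (IsCMField.complexConj L) v ξ.η (localDet (IsCMField.complexConj L) v (isUnit_antidiagOne_det L 2) (MonoidHom.inr ((cmDatum L 2 (Matrix.of fun i j : Fin 2 => if i.val + j.val + 1 = 2 then (1 : L) else 0)).Local v) ((cmDatum L 1 (Matrix.of fun i j : Fin 1 => if i.val + j.val + 1 = 1 then (1 : L) else 0)).Local v) u).1) *
          torusLocalComponent L (IsCMField.complexConj L) v ξ.ψ
            (localDet (IsCMField.complexConj L) v (isUnit_antidiagOne_det L 2) (MonoidHom.inr ((cmDatum L 2 (Matrix.of fun i j : Fin 2 => if i.val + j.val + 1 = 2 then (1 : L) else 0)).Local v) ((cmDatum L 1 (Matrix.of fun i j : Fin 1 => if i.val + j.val + 1 = 1 then (1 : L) else 0)).Local v) u).1 *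
              localDet (IsCMField.complexConj L) v (isUnit_antidiagOne_det L 1) (MonoidHom.inr ((cmDatum L 2 (Matrix.of fun i j : Fin 2 => if i.val + j.val + 1 = 2 then (1 : L) else 0)).Local v) ((cmDatum L 1 (Matrix.of fun i j : Fin 1 => if i.val + j.val + 1 = 1 then (1 : L) else 0)).Local v) u).2) :=
      OneDimAutRepH.xiLocalChar_apply_eq ξ v _
    _ = torusLocalComponent L (IsCMField.complexConj L) v ξ.ψ (localDet (IsCMField.complexConj L) v (isUnit_antidiagOne_det L 1) u) := by
      rw [e1, map_one, one_mul, one_mul]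
      rfl

/-- **`(ξ_v ∘ inr) ∘ localPiEquiv v = (ψ ∘ det) ∘ inclPlaceAdelic v`** (★ `cmDetChar_inclPlaceAdelic` at `N = 1`). [cite: Rogawski1990, §12.2 pp. 173–174] -/
theorem xiLocalChar_comp_inr_comp_localPiEquiv (ξ : OneDimAutRepH L) (v : HeightOneSpectrum (𝓞 ↥(maximalRealSubfield L))) :
    ((ξ.xiLocalChar v).comp (MonoidHom.inr ((cmDatum L 2 (Matrix.of fun i j : Fin 2 => if i.val + j.val + 1 = 2 then (1 : L) else 0)).Local v) ((cmDatum L 1 (Matrix.of fun i j : Fin 1 => if i.val + j.val + 1 = 1 then (1 : L) else 0)).Local v))).comp (localPiEquiv L (IsCMField.complexConj L) 1 (Matrix.of fun i j : Fin 1 => if i.val + j.val + 1 = 1 then (1 : L) else 0) v).toMonoidHom =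
      (cmDetChar L 1 (Matrix.of fun i j : Fin 1 => if i.val + j.val + 1 = 1 then (1 : L) else 0) ξ.ψ ξ.hψ (isUnit_antidiagOne_det L 1).ne_zero).toMonoidHom.comp (inclPlaceAdelic ↥(maximalRealSubfield L) L (IsCMField.complexConj L) 1 (Matrix.of fun i j : Fin 1 => if i.val + j.val + 1 = 1 then (1 : L) else 0) v) := by
  refine MonoidHom.ext fun k => ?_
  have a := DFunLike.congr_fun (xiLocalChar_comp_inr ξ v) ((localPiEquiv L (IsCMField.complexConj L) 1 (Matrix.of fun i j : Fin 1 => if i.val + j.val + 1 = 1 then (1 : L) else 0) v) k)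
  have b := cmDetChar_inclPlaceAdelic L 1 (Matrix.of fun i j : Fin 1 => if i.val + j.val + 1 = 1 then (1 : L) else 0) ξ.ψ ξ.hψ (isUnit_antidiagOne_det L 1).ne_zero v k
  exact a.trans b.symm

/-! ## §2 `Realises₁ P₁ ξ ↔ P₁` is the line of `(ψ ∘ det)⁻¹` -/

/-- **THE `U(1)` LINE**: a discrete automorphic representation `P₁` of `U(Φ₁)` realises the character family `ξ_v ∘ inr = ψ_v ∘ det` at every finite place
(★ `Realises₁`) IFF it is the line of the unitary automorphic character `(ψ ∘ det)⁻¹` (★ `DiscreteAutomorphicRep.ofChar`, on which `R(g) = ψ(det g)`).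
[cite: Rogawski1990, §13.3 pp. 202–203] [cite: Gelbart1975, §2.A] -/
theorem realises₁_iff_eq_ofChar {μ₁ : Measure (adelicGroupData ↥(maximalRealSubfield L) L (IsCMField.complexConj L) 1 (Matrix.of fun i j : Fin 1 => if i.val + j.val + 1 = 1 then (1 : L) else 0)).automorphicQuotient} [(adelicGroupData ↥(maximalRealSubfield L) L (IsCMField.complexConj L) 1 (Matrix.of fun i j : Fin 1 => if i.val + j.val + 1 = 1 then (1 : L) else 0)).IsAutomorphicMeasure μ₁]
    (P₁ : DiscreteAutomorphicRep (adelicGroupData ↥(maximalRealSubfield L) L (IsCMField.complexConj L) 1 (Matrix.of fun i j : Fin 1 => if i.val + j.val + 1 = 1 then (1 : L) else 0)) μ₁) (ξ : OneDimAutRepH L) :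
    Realises₁ P₁ ξ ↔ P₁ = DiscreteAutomorphicRep.ofChar (cmDetChar L 1 (Matrix.of fun i j : Fin 1 => if i.val + j.val + 1 = 1 then (1 : L) else 0) ξ.ψ ξ.hψ (isUnit_antidiagOne_det L 1).ne_zero)⁻¹ μ₁ := by
  obtain ⟨ψ₀, hP₀, hR⟩ := UnitaryGroup.exists_eq_ofChar_adelicGroupData_one L (Matrix.of fun i j : Fin 1 => if i.val + j.val + 1 = 1 then (1 : L) else 0) μ₁ P₁
  -- `P₁` is the line of `ψ₀`; its eigen-character is `ψ₀⁻¹`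
  have hχ : ∀ (g : (adelicGroupData ↥(maximalRealSubfield L) L (IsCMField.complexConj L) 1 (Matrix.of fun i j : Fin 1 => if i.val + j.val + 1 = 1 then (1 : L) else 0)).Adelic) (f : P₁.space.toSubmodule), P₁.space.toContRep g f = ((ψ₀⁻¹ g : ℂˣ) : ℂ) • f := fun g f => by
    rw [hR g f, AdelicGroupData.AutomorphicCharacter.coe_inv_apply]
  -- the finite constituents of `P₁` at `v` are `{⟦ψ₀⁻¹ ∘ ι_v⟧}` (★ `CharacterLineFinConstituents`)
  have key : ∀ (v : HeightOneSpectrum (𝓞 ↥(maximalRealSubfield L))) (c : IrrClass ((cmDatum L 1 (Matrix.of fun i j : Fin 1 => if i.val + j.val + 1 = 1 then (1 : L) else 0)).Local v)),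
      IsFinConstituentAt₁ P₁ v c ↔ IrrClass.comap (localPiEquiv L (IsCMField.complexConj L) 1 (Matrix.of fun i j : Fin 1 => if i.val + j.val + 1 = 1 then (1 : L) else 0) v) c =
        IrrClass.mk (SmoothIrrep.ofChar (ψ₀⁻¹.toMonoidHom.comp (inclPlaceAdelic ↥(maximalRealSubfield L) L (IsCMField.complexConj L) 1 (Matrix.of fun i j : Fin 1 => if i.val + j.val + 1 = 1 then (1 : L) else 0) v))
          (isOpen_ker_comp_inclPlaceAdelic ψ₀⁻¹.toMonoidHom ψ₀⁻¹.continuous v)) := fun v c =>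
    isConstituentOf_finRep_smoothPart_comp_inclPlace_iff_of_forall_apply_eq_smul P₁ ψ₀⁻¹.toMonoidHom ψ₀⁻¹.continuous hχ v _
  -- `Realises₁ P₁ ξ ↔` the two character families `ψ₀⁻¹ ∘ ι_v`, `(ψ ∘ det) ∘ ι_v` agree at every `v`
  have step : Realises₁ P₁ ξ ↔ ∀ v : HeightOneSpectrum (𝓞 ↥(maximalRealSubfield L)),
      ψ₀⁻¹.toMonoidHom.comp (inclPlaceAdelic ↥(maximalRealSubfield L) L (IsCMField.complexConj L) 1 (Matrix.of fun i j : Fin 1 => if i.val + j.val + 1 = 1 then (1 : L) else 0) v) = (cmDetChar L 1 (Matrix.of fun i j : Fin 1 => if i.val + j.val + 1 = 1 then (1 : L) else 0) ξ.ψ ξ.hψ (isUnit_antidiagOne_det L 1).ne_zero).toMonoidHom.comp (inclPlaceAdelic ↥(maximalRealSubfield L) L (IsCMField.complexConj L) 1 (Matrix.of fun i j : Fin 1 => if i.val + j.val + 1 = 1 then (1 : L) else 0) v) := by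
    constructor
    · intro H v
      have H1 : IsFinConstituentAt₁ P₁ v (IrrClass.mk (SmoothIrrep.ofChar ((ξ.xiLocalChar v).comp (MonoidHom.inr ((cmDatum L 2 (Matrix.of fun i j : Fin 2 => if i.val + j.val + 1 = 2 then (1 : L) else 0)).Local v) ((cmDatum L 1 (Matrix.of fun i j : Fin 1 => if i.val + j.val + 1 = 1 then (1 : L) else 0)).Local v))) (isOpen_ker_xiLocalChar_comp_inr ξ v))) := (H v _).2 rfl
      have H2 := (key v _).1 H1
      have H3 := (comap_mk_ofChar (localPiEquiv L (IsCMField.complexConj L) 1 (Matrix.of fun i j : Fin 1 => if i.val + j.val + 1 = 1 then (1 : L) else 0) v) ((ξ.xiLocalChar v).comp (MonoidHom.inr ((cmDatum L 2 (Matrix.of fun i j : Fin 2 => if i.val + j.val + 1 = 2 then (1 : L) else 0)).Local v) ((cmDatum L 1 (Matrix.of fun i j : Fin 1 => if i.val + j.val + 1 = 1 then (1 : L) else 0)).Local v))) (isOpen_ker_xiLocalChar_comp_inr ξ v)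
        (isOpen_ker_comp_equiv (localPiEquiv L (IsCMField.complexConj L) 1 (Matrix.of fun i j : Fin 1 => if i.val + j.val + 1 = 1 then (1 : L) else 0) v) _ (isOpen_ker_xiLocalChar_comp_inr ξ v))).symm.trans H2
      have H4 := (IrrClass.mk_ofChar_eq_mk_ofChar_iff _ _).1 H3
      rw [← H4]
      exact xiLocalChar_comp_inr_comp_localPiEquiv ξ v
    · intro H v c
      refine (key v c).trans ?_
      have hcl : IrrClass.mk (SmoothIrrep.ofChar (ψ₀⁻¹.toMonoidHom.comp (inclPlaceAdelic ↥(maximalRealSubfield L) L (IsCMField.complexConj L) 1 (Matrix.of fun i j : Fin 1 => if i.val + j.val + 1 = 1 then (1 : L) else 0) v)) (isOpen_ker_comp_inclPlaceAdelic ψ₀⁻¹.toMonoidHom ψ₀⁻¹.continuous v)) =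
          IrrClass.comap (localPiEquiv L (IsCMField.complexConj L) 1 (Matrix.of fun i j : Fin 1 => if i.val + j.val + 1 = 1 then (1 : L) else 0) v) (IrrClass.mk (SmoothIrrep.ofChar ((ξ.xiLocalChar v).comp (MonoidHom.inr ((cmDatum L 2 (Matrix.of fun i j : Fin 2 => if i.val + j.val + 1 = 2 then (1 : L) else 0)).Local v) ((cmDatum L 1 (Matrix.of fun i j : Fin 1 => if i.val + j.val + 1 = 1 then (1 : L) else 0)).Local v))) ((F0P3XiLocalCharOpenKernel.isOpen_ker_xiLocalChar L ξ v).preimage (Continuous.prodMk_right 1)))) :=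
        ((IrrClass.mk_ofChar_eq_mk_ofChar_iff (isOpen_ker_comp_inclPlaceAdelic ψ₀⁻¹.toMonoidHom ψ₀⁻¹.continuous v)
            (isOpen_ker_comp_equiv (localPiEquiv L (IsCMField.complexConj L) 1 (Matrix.of fun i j : Fin 1 => if i.val + j.val + 1 = 1 then (1 : L) else 0) v) _ (isOpen_ker_xiLocalChar_comp_inr ξ v))).2
          ((H v).trans (xiLocalChar_comp_inr_comp_localPiEquiv ξ v).symm)).trans
          (comap_mk_ofChar (localPiEquiv L (IsCMField.complexConj L) 1 (Matrix.of fun i j : Fin 1 => if i.val + j.val + 1 = 1 then (1 : L) else 0) v) ((ξ.xiLocalChar v).comp (MonoidHom.inr ((cmDatum L 2 (Matrix.of fun i j : Fin 2 => if i.val + j.val + 1 = 2 then (1 : L) else 0)).Local v) ((cmDatum L 1 (Matrix.of fun i j : Fin 1 => if i.val + j.val + 1 = 1 then (1 : L) else 0)).Local v))) (isOpen_ker_xiLocalChar_comp_inr ξ v) _).symm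
      rw [hcl]
      exact (IrrClass.comap_injective _).eq_iff
  -- rigidity (★ Tate density, `N = 1`): agreement at every `v` is `ψ₀⁻¹ = ψ ∘ det`
  have step2 : (∀ v : HeightOneSpectrum (𝓞 ↥(maximalRealSubfield L)), ψ₀⁻¹.toMonoidHom.comp (inclPlaceAdelic ↥(maximalRealSubfield L) L (IsCMField.complexConj L) 1 (Matrix.of fun i j : Fin 1 => if i.val + j.val + 1 = 1 then (1 : L) else 0) v) = (cmDetChar L 1 (Matrix.of fun i j : Fin 1 => if i.val + j.val + 1 = 1 then (1 : L) else 0) ξ.ψ ξ.hψ (isUnit_antidiagOne_det L 1).ne_zero).toMonoidHom.comp (inclPlaceAdelic ↥(maximalRealSubfield L) L (IsCMField.complexConj L) 1 (Matrix.of fun i j : Fin 1 => if i.val + j.val + 1 = 1 then (1 : L) else 0) v)) ↔ ψ₀⁻¹ = (cmDetChar L 1 (Matrix.of fun i j : Fin 1 => if i.val + j.val + 1 = 1 then (1 : L) else 0) ξ.ψ ξ.hψ (isUnit_antidiagOne_det L 1).ne_zero) :=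
    ⟨fun H => cm_eq_of_forall_comp_inclPlaceAdelic_eq_of_one L (Matrix.of fun i j : Fin 1 => if i.val + j.val + 1 = 1 then (1 : L) else 0) (isUnit_antidiagOne_det L 1).ne_zero ∅ _ _ fun v _ => H v, fun H v => by rw [H]⟩
  rw [step, step2, hP₀]
  constructor
  · intro H
    rw [← AdelicGroupData.AutomorphicCharacter.inv_inv ψ₀, H]
  · intro H
    have H' : ψ₀ = (cmDetChar L 1 (Matrix.of fun i j : Fin 1 => if i.val + j.val + 1 = 1 then (1 : L) else 0) ξ.ψ ξ.hψ (isUnit_antidiagOne_det L 1).ne_zero)⁻¹ := DiscreteAutomorphicRep.ofChar_injective μ₁ H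
    rw [H', AdelicGroupData.AutomorphicCharacter.inv_inv]

/-- **EXISTENCE, EXPLICIT**: the line of `(ψ ∘ det)⁻¹` realises `ξ_v ∘ inr`. [cite: Rogawski1990, §13.3 pp. 202–203] -/
theorem realises₁_ofChar {μ₁ : Measure (adelicGroupData ↥(maximalRealSubfield L) L (IsCMField.complexConj L) 1 (Matrix.of fun i j : Fin 1 => if i.val + j.val + 1 = 1 then (1 : L) else 0)).automorphicQuotient} [(adelicGroupData ↥(maximalRealSubfield L) L (IsCMField.complexConj L) 1 (Matrix.of fun i j : Fin 1 => if i.val + j.val + 1 = 1 then (1 : L) else 0)).IsAutomorphicMeasure μ₁] (ξ : OneDimAutRepH L) :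
    Realises₁ (DiscreteAutomorphicRep.ofChar (cmDetChar L 1 (Matrix.of fun i j : Fin 1 => if i.val + j.val + 1 = 1 then (1 : L) else 0) ξ.ψ ξ.hψ (isUnit_antidiagOne_det L 1).ne_zero)⁻¹ μ₁) ξ :=
  (realises₁_iff_eq_ofChar _ ξ).2 rfl

/-- **EXISTENCE**: some discrete automorphic representation of `U(Φ₁)` realises `ξ_v ∘ inr` — the `∃ P₁, Realises₁ P₁ ξ` premise of the leaf row (KD5-H♭).
[cite: Rogawski1990, §13.3 pp. 202–203] -/
theorem exists_realises₁ (μ₁ : Measure (adelicGroupData ↥(maximalRealSubfield L) L (IsCMField.complexConj L) 1 (Matrix.of fun i j : Fin 1 => if i.val + j.val + 1 = 1 then (1 : L) else 0)).automorphicQuotient) [(adelicGroupData ↥(maximalRealSubfield L) L (IsCMField.complexConj L) 1 (Matrix.of fun i j : Fin 1 => if i.val + j.val + 1 = 1 then (1 : L) else 0)).IsAutomorphicMeasure μ₁] (ξ : OneDimAutRepH L) :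
    ∃ P₁ : DiscreteAutomorphicRep (adelicGroupData ↥(maximalRealSubfield L) L (IsCMField.complexConj L) 1 (Matrix.of fun i j : Fin 1 => if i.val + j.val + 1 = 1 then (1 : L) else 0)) μ₁, Realises₁ P₁ ξ :=
  ⟨_, realises₁_ofChar ξ⟩

/-- **UNIQUENESS (multiplicity one on `U(1)`)**: two discrete automorphic representations of `U(Φ₁)` realising `ξ_v ∘ inr` coincide — the
`∀ P₁ P₁′, Realises₁ P₁ ξ → Realises₁ P₁′ ξ → P₁ = P₁′` premise of the leaf row (KD5-H♭). [cite: Rogawski1990, §13.3 p. 203] [cite: Gelbart1975, Thm. 10.10 (proof, p. 158)] -/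
theorem realises₁_unique {μ₁ : Measure (adelicGroupData ↥(maximalRealSubfield L) L (IsCMField.complexConj L) 1 (Matrix.of fun i j : Fin 1 => if i.val + j.val + 1 = 1 then (1 : L) else 0)).automorphicQuotient} [(adelicGroupData ↥(maximalRealSubfield L) L (IsCMField.complexConj L) 1 (Matrix.of fun i j : Fin 1 => if i.val + j.val + 1 = 1 then (1 : L) else 0)).IsAutomorphicMeasure μ₁] (ξ : OneDimAutRepH L)
    (P₁ P₁' : DiscreteAutomorphicRep (adelicGroupData ↥(maximalRealSubfield L) L (IsCMField.complexConj L) 1 (Matrix.of fun i j : Fin 1 => if i.val + j.val + 1 = 1 then (1 : L) else 0)) μ₁) (h : Realises₁ P₁ ξ) (h' : Realises₁ P₁' ξ) : P₁ = P₁' := by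
  rw [(realises₁_iff_eq_ofChar P₁ ξ).1 h, (realises₁_iff_eq_ofChar P₁' ξ).1 h']

/-- **EXACTLY ONE** discrete automorphic representation of `U(Φ₁)` realises `ξ_v ∘ inr`. [cite: Rogawski1990, §13.3 pp. 202–203] -/
theorem existsUnique_realises₁ (μ₁ : Measure (adelicGroupData ↥(maximalRealSubfield L) L (IsCMField.complexConj L) 1 (Matrix.of fun i j : Fin 1 => if i.val + j.val + 1 = 1 then (1 : L) else 0)).automorphicQuotient) [(adelicGroupData ↥(maximalRealSubfield L) L (IsCMField.complexConj L) 1 (Matrix.of fun i j : Fin 1 => if i.val + j.val + 1 = 1 then (1 : L) else 0)).IsAutomorphicMeasure μ₁] (ξ : OneDimAutRepH L) :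
    ∃! P₁ : DiscreteAutomorphicRep (adelicGroupData ↥(maximalRealSubfield L) L (IsCMField.complexConj L) 1 (Matrix.of fun i j : Fin 1 => if i.val + j.val + 1 = 1 then (1 : L) else 0)) μ₁, Realises₁ P₁ ξ :=
  ⟨_, realises₁_ofChar ξ, fun P₁ h => (realises₁_iff_eq_ofChar P₁ ξ).1 h⟩

/-! ## §3 An occurring character family of `U(Φ₁)` equal to `ξ_v ∘ inr` almost everywhere is `ξ_v ∘ inr` everywhere -/

/-- **«a.e. ⇒ everywhere» on `U(Φ₁)`**: let `χ₁ = (χ₁,v)_v` be smooth characters of the `U(Φ₁)(L⁺_v)` whose classes OCCUR in the discrete spectrum of `μ₁`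
(★ `cmOccursInDiscreteSpectrum`, `N = 1`).  If `χ₁,v = ξ_v ∘ inr` for all but finitely many finite `v`, then `χ₁,v = ξ_v ∘ inr` for EVERY finite `v`:
the realising `P` is the line of some `ψ₀` (★ `exists_eq_ofChar_adelicGroupData_one`), its finite component `σ ↪ P|_{U(𝔸_f)}` is `ψ₀⁻¹`-scalar, so
`χ₁,v ∘ localPiEquiv v = ψ₀⁻¹ ∘ ι_v` (★ scalar constituents), hence `ψ₀⁻¹` and `ψ ∘ det` agree on `U(Φ₁)(L⁺_v)` off a finite set and are EQUAL (★ rigidity,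
`N = 1`), which gives the identity at every `v`. [cite: Rogawski1990, §13.3 pp. 202–203] [cite: CasselsFrohlichANT1967, Ch. VII §4 Prop. 4.1 (proof)] -/
theorem forall_eq_of_cmOccursInDiscreteSpectrum_of_eventually_eq {μ₁ : Measure (adelicGroupData ↥(maximalRealSubfield L) L (IsCMField.complexConj L) 1 (Matrix.of fun i j : Fin 1 => if i.val + j.val + 1 = 1 then (1 : L) else 0)).automorphicQuotient} [(adelicGroupData ↥(maximalRealSubfield L) L (IsCMField.complexConj L) 1 (Matrix.of fun i j : Fin 1 => if i.val + j.val + 1 = 1 then (1 : L) else 0)).IsAutomorphicMeasure μ₁]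
    (χ₁ : ∀ v : HeightOneSpectrum (𝓞 ↥(maximalRealSubfield L)), ((cmDatum L 1 (Matrix.of fun i j : Fin 1 => if i.val + j.val + 1 = 1 then (1 : L) else 0)).Local v) →* ℂˣ)
    (hχ₁ : ∀ v : HeightOneSpectrum (𝓞 ↥(maximalRealSubfield L)), IsOpen (((χ₁ v).ker : Subgroup ((cmDatum L 1 (Matrix.of fun i j : Fin 1 => if i.val + j.val + 1 = 1 then (1 : L) else 0)).Local v)) : Set ((cmDatum L 1 (Matrix.of fun i j : Fin 1 => if i.val + j.val + 1 = 1 then (1 : L) else 0)).Local v)))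
    (hocc : cmOccursInDiscreteSpectrum L 1 (Matrix.of fun i j : Fin 1 => if i.val + j.val + 1 = 1 then (1 : L) else 0) μ₁ fun v => IrrClass.mk (SmoothIrrep.ofChar (χ₁ v) (hχ₁ v)))
    (ξ : OneDimAutRepH L)
    (hae : ∀ᶠ v : HeightOneSpectrum (𝓞 ↥(maximalRealSubfield L)) in Filter.cofinite, χ₁ v = ((ξ.xiLocalChar v).comp (MonoidHom.inr ((cmDatum L 2 (Matrix.of fun i j : Fin 2 => if i.val + j.val + 1 = 2 then (1 : L) else 0)).Local v) ((cmDatum L 1 (Matrix.of fun i j : Fin 1 => if i.val + j.val + 1 = 1 then (1 : L) else 0)).Local v)))) :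
    ∀ v : HeightOneSpectrum (𝓞 ↥(maximalRealSubfield L)), χ₁ v = ((ξ.xiLocalChar v).comp (MonoidHom.inr ((cmDatum L 2 (Matrix.of fun i j : Fin 2 => if i.val + j.val + 1 = 2 then (1 : L) else 0)).Local v) ((cmDatum L 1 (Matrix.of fun i j : Fin 1 => if i.val + j.val + 1 = 1 then (1 : L) else 0)).Local v))) := by
  obtain ⟨P, W, _, _, σ, hirr, -, -, ⟨f, hf⟩, hcons⟩ := (cmOccursInDiscreteSpectrum_iff L 1 (Matrix.of fun i j : Fin 1 => if i.val + j.val + 1 = 1 then (1 : L) else 0) μ₁ _).1 hocc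
  obtain ⟨ψ₀, -, hR⟩ := UnitaryGroup.exists_eq_ofChar_adelicGroupData_one L (Matrix.of fun i j : Fin 1 => if i.val + j.val + 1 = 1 then (1 : L) else 0) μ₁ P
  have hχ : ∀ (g : (adelicGroupData ↥(maximalRealSubfield L) L (IsCMField.complexConj L) 1 (Matrix.of fun i j : Fin 1 => if i.val + j.val + 1 = 1 then (1 : L) else 0)).Adelic) (x : P.space.toSubmodule), P.space.toContRep g x = ((ψ₀⁻¹ g : ℂˣ) : ℂ) • x := fun g x => by
    rw [hR g x, AdelicGroupData.AutomorphicCharacter.coe_inv_apply]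
  -- the finite component `σ ↪ P|_{U(𝔸_f)}` is `ψ₀⁻¹ ∘ finAdelicToAdelic`-scalar
  have hσ : ∀ (y : finAdelic ↥(maximalRealSubfield L) L (IsCMField.complexConj L) 1 (Matrix.of fun i j : Fin 1 => if i.val + j.val + 1 = 1 then (1 : L) else 0)) (w : W),
      σ y w = (((ψ₀⁻¹.toMonoidHom.comp (finAdelicToAdelic ↥(maximalRealSubfield L) L (IsCMField.complexConj L) 1 (Matrix.of fun i j : Fin 1 => if i.val + j.val + 1 = 1 then (1 : L) else 0))) y : ℂˣ) : ℂ) • w := by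
    intro y w
    apply hf
    change f.toLinearMap (σ y w) = f.toLinearMap _
    have h1 := LinearMap.congr_fun (f.isIntertwining' y) w
    simp only [LinearMap.comp_apply] at h1
    rw [h1, map_smul]
    exact finRep_apply_of_forall_apply_eq_smul P ψ₀⁻¹.toMonoidHom hχ y (f.toLinearMap w)
  haveI : σ.IsIrreducible := hirr
  haveI : Nontrivial W := IrrClass.nontrivial_of_isIrreducible σ
  -- so the constituents of `σ|_v` are `{⟦ψ₀⁻¹ ∘ ι_v⟧}`, and the occurring family reads `χ₁ v ∘ localPiEquiv v = ψ₀⁻¹ ∘ ι_v`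
  have hv : ∀ v : HeightOneSpectrum (𝓞 ↥(maximalRealSubfield L)), (χ₁ v).comp (localPiEquiv L (IsCMField.complexConj L) 1 (Matrix.of fun i j : Fin 1 => if i.val + j.val + 1 = 1 then (1 : L) else 0) v).toMonoidHom = ψ₀⁻¹.toMonoidHom.comp (inclPlaceAdelic ↥(maximalRealSubfield L) L (IsCMField.complexConj L) 1 (Matrix.of fun i j : Fin 1 => if i.val + j.val + 1 = 1 then (1 : L) else 0) v) := by
    intro v
    have h1 := (hcons v _).2 rfl
    have h2 := (IrrClass.isConstituentOf_comp_iff_eq_mk_ofChar_of_forall_apply_eq_smul σ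
      (ψ₀⁻¹.toMonoidHom.comp (finAdelicToAdelic ↥(maximalRealSubfield L) L (IsCMField.complexConj L) 1 (Matrix.of fun i j : Fin 1 => if i.val + j.val + 1 = 1 then (1 : L) else 0))) (inclPlace ↥(maximalRealSubfield L) L (IsCMField.complexConj L) 1 (Matrix.of fun i j : Fin 1 => if i.val + j.val + 1 = 1 then (1 : L) else 0) v)
      (isOpen_ker_comp_inclPlaceAdelic ψ₀⁻¹.toMonoidHom ψ₀⁻¹.continuous v) hσ _).1 h1
    have h3 := (comap_mk_ofChar (localPiEquiv L (IsCMField.complexConj L) 1 (Matrix.of fun i j : Fin 1 => if i.val + j.val + 1 = 1 then (1 : L) else 0) v) (χ₁ v) (hχ₁ v) (isOpen_ker_comp_equiv (localPiEquiv L (IsCMField.complexConj L) 1 (Matrix.of fun i j : Fin 1 => if i.val + j.val + 1 = 1 then (1 : L) else 0) v) _ (hχ₁ v))).symm.trans h2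
    exact (IrrClass.mk_ofChar_eq_mk_ofChar_iff _ _).1 h3
  -- off the finite exceptional set, `ψ₀⁻¹ ∘ ι_v = (ψ ∘ det) ∘ ι_v`
  have hfin : {v : HeightOneSpectrum (𝓞 ↥(maximalRealSubfield L)) | ¬ χ₁ v = ((ξ.xiLocalChar v).comp (MonoidHom.inr ((cmDatum L 2 (Matrix.of fun i j : Fin 2 => if i.val + j.val + 1 = 2 then (1 : L) else 0)).Local v) ((cmDatum L 1 (Matrix.of fun i j : Fin 1 => if i.val + j.val + 1 = 1 then (1 : L) else 0)).Local v)))}.Finite := Filter.eventually_cofinite.1 hae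
  have hS : ∀ v : HeightOneSpectrum (𝓞 ↥(maximalRealSubfield L)), v ∉ hfin.toFinset →
      ψ₀⁻¹.toMonoidHom.comp (inclPlaceAdelic ↥(maximalRealSubfield L) L (IsCMField.complexConj L) 1 (Matrix.of fun i j : Fin 1 => if i.val + j.val + 1 = 1 then (1 : L) else 0) v) = (cmDetChar L 1 (Matrix.of fun i j : Fin 1 => if i.val + j.val + 1 = 1 then (1 : L) else 0) ξ.ψ ξ.hψ (isUnit_antidiagOne_det L 1).ne_zero).toMonoidHom.comp (inclPlaceAdelic ↥(maximalRealSubfield L) L (IsCMField.complexConj L) 1 (Matrix.of fun i j : Fin 1 => if i.val + j.val + 1 = 1 then (1 : L) else 0) v) := by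
    intro v hv'
    have hv1 : χ₁ v = ((ξ.xiLocalChar v).comp (MonoidHom.inr ((cmDatum L 2 (Matrix.of fun i j : Fin 2 => if i.val + j.val + 1 = 2 then (1 : L) else 0)).Local v) ((cmDatum L 1 (Matrix.of fun i j : Fin 1 => if i.val + j.val + 1 = 1 then (1 : L) else 0)).Local v))) := by
      by_contra hne
      exact hv' (hfin.mem_toFinset.2 hne)
    rw [← hv v, hv1]
    exact xiLocalChar_comp_inr_comp_localPiEquiv ξ v
  have hθ : ψ₀⁻¹ = (cmDetChar L 1 (Matrix.of fun i j : Fin 1 => if i.val + j.val + 1 = 1 then (1 : L) else 0) ξ.ψ ξ.hψ (isUnit_antidiagOne_det L 1).ne_zero) :=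
    cm_eq_of_forall_comp_inclPlaceAdelic_eq_of_one L (Matrix.of fun i j : Fin 1 => if i.val + j.val + 1 = 1 then (1 : L) else 0) (isUnit_antidiagOne_det L 1).ne_zero hfin.toFinset _ _ hS
  -- hence the identity at EVERY `v` (cancel the isomorphism `localPiEquiv v`)
  intro v
  have h5 : ψ₀⁻¹.toMonoidHom.comp (inclPlaceAdelic ↥(maximalRealSubfield L) L (IsCMField.complexConj L) 1 (Matrix.of fun i j : Fin 1 => if i.val + j.val + 1 = 1 then (1 : L) else 0) v) = (cmDetChar L 1 (Matrix.of fun i j : Fin 1 => if i.val + j.val + 1 = 1 then (1 : L) else 0) ξ.ψ ξ.hψ (isUnit_antidiagOne_det L 1).ne_zero).toMonoidHom.comp (inclPlaceAdelic ↥(maximalRealSubfield L) L (IsCMField.complexConj L) 1 (Matrix.of fun i j : Fin 1 => if i.val + j.val + 1 = 1 then (1 : L) else 0) v) := by rw [hθ]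
  have h3 : (χ₁ v).comp (localPiEquiv L (IsCMField.complexConj L) 1 (Matrix.of fun i j : Fin 1 => if i.val + j.val + 1 = 1 then (1 : L) else 0) v).toMonoidHom = ((ξ.xiLocalChar v).comp (MonoidHom.inr ((cmDatum L 2 (Matrix.of fun i j : Fin 2 => if i.val + j.val + 1 = 2 then (1 : L) else 0)).Local v) ((cmDatum L 1 (Matrix.of fun i j : Fin 1 => if i.val + j.val + 1 = 1 then (1 : L) else 0)).Local v))).comp (localPiEquiv L (IsCMField.complexConj L) 1 (Matrix.of fun i j : Fin 1 => if i.val + j.val + 1 = 1 then (1 : L) else 0) v).toMonoidHom :=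
    (hv v).trans (h5.trans (xiLocalChar_comp_inr_comp_localPiEquiv ξ v).symm)
  refine MonoidHom.ext fun u => ?_
  obtain ⟨k, rfl⟩ := (localPiEquiv L (IsCMField.complexConj L) 1 (Matrix.of fun i j : Fin 1 => if i.val + j.val + 1 = 1 then (1 : L) else 0) v).surjective u
  exact DFunLike.congr_fun h3 k

/-! ## §4 (ED. 2) The `U(Φ₂)`-side EXISTENCE: the line of `((η ψ) ∘ det)⁻¹` realises `ξ_v ∘ inl = (η_v ψ_v) ∘ det₀`
(the `∃ P₂, Realises₂ P₂ ξ` premise of (KD5-H♭); uniqueness on `U(Φ₂)` is the PRINT letter O8b and is NOT claimed here) -/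

/-- The product `η ψ` of the two automorphic characters of a one-dimensional `ξ` is automorphic. [cite: Rogawski1990, §13.3 p. 202] -/
theorem isAutomorphic_eta_mul_psi (ξ : OneDimAutRepH L) : TorusDict.IsAutomorphic (IsCMField.complexConj L) (ξ.η * ξ.ψ) := fun t ht => by
  change ξ.η t * ξ.ψ t = 1
  rw [ξ.hη t ht, ξ.hψ t ht, one_mul]

/-- The open kernel of `ξ_v ∘ inl` (★ `isOpen_ker_xiLocalChar`, pulled back along `x ↦ (x, 1)`), in the `Subgroup`-coercion spelling. [cite: Rogawski1990, §12.1 p. 171] -/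
theorem isOpen_ker_xiLocalChar_comp_inl (ξ : OneDimAutRepH L) (v : HeightOneSpectrum (𝓞 ↥(maximalRealSubfield L))) :
    IsOpen ((((ξ.xiLocalChar v).comp (MonoidHom.inl ((cmDatum L 2 (Matrix.of fun i j : Fin 2 => if i.val + j.val + 1 = 2 then (1 : L) else 0)).Local v) ((cmDatum L 1 (Matrix.of fun i j : Fin 1 => if i.val + j.val + 1 = 1 then (1 : L) else 0)).Local v))).ker : Subgroup ((cmDatum L 2 (Matrix.of fun i j : Fin 2 => if i.val + j.val + 1 = 2 then (1 : L) else 0)).Local v)) : Set ((cmDatum L 2 (Matrix.of fun i j : Fin 2 => if i.val + j.val + 1 = 2 then (1 : L) else 0)).Local v)) :=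
  ((F0P3XiLocalCharOpenKernel.isOpen_ker_xiLocalChar L ξ v).preimage (Continuous.prodMk_left 1))

/-- **`ξ_v ∘ inl = (η_v ψ_v) ∘ det₀`** on the `U(Φ₂)`-factor (`ψ_v(det₀ h · det 1) = ψ_v(det₀ h)`; ★ `xiLocalChar_apply_eq`). [cite: Rogawski1990, §13.3 p. 202] -/
theorem xiLocalChar_comp_inl (ξ : OneDimAutRepH L) (v : HeightOneSpectrum (𝓞 ↥(maximalRealSubfield L))) :
    ((ξ.xiLocalChar v).comp (MonoidHom.inl ((cmDatum L 2 (Matrix.of fun i j : Fin 2 => if i.val + j.val + 1 = 2 then (1 : L) else 0)).Local v) ((cmDatum L 1 (Matrix.of fun i j : Fin 1 => if i.val + j.val + 1 = 1 then (1 : L) else 0)).Local v))) =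
      (torusLocalComponent L (IsCMField.complexConj L) v (ξ.η * ξ.ψ)).comp (localDet (IsCMField.complexConj L) v (isUnit_antidiagOne_det L 2)) := by
  refine MonoidHom.ext fun h₀ => ?_
  have e1 : localDet (IsCMField.complexConj L) v (isUnit_antidiagOne_det L 1) (MonoidHom.inl ((cmDatum L 2 (Matrix.of fun i j : Fin 2 => if i.val + j.val + 1 = 2 then (1 : L) else 0)).Local v) ((cmDatum L 1 (Matrix.of fun i j : Fin 1 => if i.val + j.val + 1 = 1 then (1 : L) else 0)).Local v) h₀).2 = 1 :=
    map_one (localDet (IsCMField.complexConj L) v (isUnit_antidiagOne_det L 1))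
  calc ((ξ.xiLocalChar v).comp (MonoidHom.inl ((cmDatum L 2 (Matrix.of fun i j : Fin 2 => if i.val + j.val + 1 = 2 then (1 : L) else 0)).Local v) ((cmDatum L 1 (Matrix.of fun i j : Fin 1 => if i.val + j.val + 1 = 1 then (1 : L) else 0)).Local v))) h₀
        = ξ.xiLocalChar v (MonoidHom.inl ((cmDatum L 2 (Matrix.of fun i j : Fin 2 => if i.val + j.val + 1 = 2 then (1 : L) else 0)).Local v) ((cmDatum L 1 (Matrix.of fun i j : Fin 1 => if i.val + j.val + 1 = 1 then (1 : L) else 0)).Local v) h₀) := rfl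
    _ = torusLocalComponent L (IsCMField.complexConj L) v ξ.η (localDet (IsCMField.complexConj L) v (isUnit_antidiagOne_det L 2) (MonoidHom.inl ((cmDatum L 2 (Matrix.of fun i j : Fin 2 => if i.val + j.val + 1 = 2 then (1 : L) else 0)).Local v) ((cmDatum L 1 (Matrix.of fun i j : Fin 1 => if i.val + j.val + 1 = 1 then (1 : L) else 0)).Local v) h₀).1) *
          torusLocalComponent L (IsCMField.complexConj L) v ξ.ψ
            (localDet (IsCMField.complexConj L) v (isUnit_antidiagOne_det L 2) (MonoidHom.inl ((cmDatum L 2 (Matrix.of fun i j : Fin 2 => if i.val + j.val + 1 = 2 then (1 : L) else 0)).Local v) ((cmDatum L 1 (Matrix.of fun i j : Fin 1 => if i.val + j.val + 1 = 1 then (1 : L) else 0)).Local v) h₀).1 *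
              localDet (IsCMField.complexConj L) v (isUnit_antidiagOne_det L 1) (MonoidHom.inl ((cmDatum L 2 (Matrix.of fun i j : Fin 2 => if i.val + j.val + 1 = 2 then (1 : L) else 0)).Local v) ((cmDatum L 1 (Matrix.of fun i j : Fin 1 => if i.val + j.val + 1 = 1 then (1 : L) else 0)).Local v) h₀).2) :=
      OneDimAutRepH.xiLocalChar_apply_eq ξ v _
    _ = torusLocalComponent L (IsCMField.complexConj L) v (ξ.η * ξ.ψ) (localDet (IsCMField.complexConj L) v (isUnit_antidiagOne_det L 2) h₀) := by
      rw [e1, mul_one]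
      rfl

/-- **`(ξ_v ∘ inl) ∘ localPiEquiv v = ((η ψ) ∘ det) ∘ inclPlaceAdelic v`** on `U(Φ₂)` (★ `cmDetChar_inclPlaceAdelic` at `N = 2`). [cite: Rogawski1990, §12.2 pp. 173–174] -/
theorem xiLocalChar_comp_inl_comp_localPiEquiv (ξ : OneDimAutRepH L) (v : HeightOneSpectrum (𝓞 ↥(maximalRealSubfield L))) :
    ((ξ.xiLocalChar v).comp (MonoidHom.inl ((cmDatum L 2 (Matrix.of fun i j : Fin 2 => if i.val + j.val + 1 = 2 then (1 : L) else 0)).Local v) ((cmDatum L 1 (Matrix.of fun i j : Fin 1 => if i.val + j.val + 1 = 1 then (1 : L) else 0)).Local v))).comp (localPiEquiv L (IsCMField.complexConj L) 2 (Matrix.of fun i j : Fin 2 => if i.val + j.val + 1 = 2 then (1 : L) else 0) v).toMonoidHom =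
      (cmDetChar L 2 (Matrix.of fun i j : Fin 2 => if i.val + j.val + 1 = 2 then (1 : L) else 0) (ξ.η * ξ.ψ) (isAutomorphic_eta_mul_psi ξ) (isUnit_antidiagOne_det L 2).ne_zero).toMonoidHom.comp (inclPlaceAdelic ↥(maximalRealSubfield L) L (IsCMField.complexConj L) 2 (Matrix.of fun i j : Fin 2 => if i.val + j.val + 1 = 2 then (1 : L) else 0) v) := by
  refine MonoidHom.ext fun k => ?_
  have a := DFunLike.congr_fun (xiLocalChar_comp_inl ξ v) ((localPiEquiv L (IsCMField.complexConj L) 2 (Matrix.of fun i j : Fin 2 => if i.val + j.val + 1 = 2 then (1 : L) else 0) v) k)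
  have b := cmDetChar_inclPlaceAdelic L 2 (Matrix.of fun i j : Fin 2 => if i.val + j.val + 1 = 2 then (1 : L) else 0) (ξ.η * ξ.ψ) (isAutomorphic_eta_mul_psi ξ) (isUnit_antidiagOne_det L 2).ne_zero v k
  exact a.trans b.symm

/-- **A CHARACTER LINE OF `U(Φ₂)` REALISING `ξ_v ∘ inl`**: if `U(Φ₂)(𝔸)` acts on the discrete automorphic `P₂` through the character `(η ψ) ∘ det`,
then `Realises₂ P₂ ξ`. [cite: Rogawski1990, §13.3 pp. 202–203] -/
theorem realises₂_of_forall_apply_eq_smul {μ₂ : Measure (adelicGroupData ↥(maximalRealSubfield L) L (IsCMField.complexConj L) 2 (Matrix.of fun i j : Fin 2 => if i.val + j.val + 1 = 2 then (1 : L) else 0)).automorphicQuotient} [(adelicGroupData ↥(maximalRealSubfield L) L (IsCMField.complexConj L) 2 (Matrix.of fun i j : Fin 2 => if i.val + j.val + 1 = 2 then (1 : L) else 0)).IsAutomorphicMeasure μ₂]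
    (P₂ : DiscreteAutomorphicRep (adelicGroupData ↥(maximalRealSubfield L) L (IsCMField.complexConj L) 2 (Matrix.of fun i j : Fin 2 => if i.val + j.val + 1 = 2 then (1 : L) else 0)) μ₂) (ξ : OneDimAutRepH L)
    (hP : ∀ (g : (adelicGroupData ↥(maximalRealSubfield L) L (IsCMField.complexConj L) 2 (Matrix.of fun i j : Fin 2 => if i.val + j.val + 1 = 2 then (1 : L) else 0)).Adelic) (f : P₂.space.toSubmodule), P₂.space.toContRep g f = (((cmDetChar L 2 (Matrix.of fun i j : Fin 2 => if i.val + j.val + 1 = 2 then (1 : L) else 0) (ξ.η * ξ.ψ) (isAutomorphic_eta_mul_psi ξ) (isUnit_antidiagOne_det L 2).ne_zero) g : ℂˣ) : ℂ) • f) :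
    Realises₂ P₂ ξ := by
  intro v c
  refine (isConstituentOf_finRep_smoothPart_comp_inclPlace_iff_of_forall_apply_eq_smul P₂ (cmDetChar L 2 (Matrix.of fun i j : Fin 2 => if i.val + j.val + 1 = 2 then (1 : L) else 0) (ξ.η * ξ.ψ) (isAutomorphic_eta_mul_psi ξ) (isUnit_antidiagOne_det L 2).ne_zero).toMonoidHom
    (cmDetChar L 2 (Matrix.of fun i j : Fin 2 => if i.val + j.val + 1 = 2 then (1 : L) else 0) (ξ.η * ξ.ψ) (isAutomorphic_eta_mul_psi ξ) (isUnit_antidiagOne_det L 2).ne_zero).continuous hP v _).trans ?_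
  have hcl : IrrClass.mk (SmoothIrrep.ofChar ((cmDetChar L 2 (Matrix.of fun i j : Fin 2 => if i.val + j.val + 1 = 2 then (1 : L) else 0) (ξ.η * ξ.ψ) (isAutomorphic_eta_mul_psi ξ) (isUnit_antidiagOne_det L 2).ne_zero).toMonoidHom.comp (inclPlaceAdelic ↥(maximalRealSubfield L) L (IsCMField.complexConj L) 2 (Matrix.of fun i j : Fin 2 => if i.val + j.val + 1 = 2 then (1 : L) else 0) v))
        (isOpen_ker_comp_inclPlaceAdelic (cmDetChar L 2 (Matrix.of fun i j : Fin 2 => if i.val + j.val + 1 = 2 then (1 : L) else 0) (ξ.η * ξ.ψ) (isAutomorphic_eta_mul_psi ξ) (isUnit_antidiagOne_det L 2).ne_zero).toMonoidHom (cmDetChar L 2 (Matrix.of fun i j : Fin 2 => if i.val + j.val + 1 = 2 then (1 : L) else 0) (ξ.η * ξ.ψ) (isAutomorphic_eta_mul_psi ξ) (isUnit_antidiagOne_det L 2).ne_zero).continuous v)) =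
      IrrClass.comap (localPiEquiv L (IsCMField.complexConj L) 2 (Matrix.of fun i j : Fin 2 => if i.val + j.val + 1 = 2 then (1 : L) else 0) v) (IrrClass.mk (SmoothIrrep.ofChar ((ξ.xiLocalChar v).comp (MonoidHom.inl ((cmDatum L 2 (Matrix.of fun i j : Fin 2 => if i.val + j.val + 1 = 2 then (1 : L) else 0)).Local v) ((cmDatum L 1 (Matrix.of fun i j : Fin 1 => if i.val + j.val + 1 = 1 then (1 : L) else 0)).Local v))) ((F0P3XiLocalCharOpenKernel.isOpen_ker_xiLocalChar L ξ v).preimage (Continuous.prodMk_left 1)))) :=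
    ((IrrClass.mk_ofChar_eq_mk_ofChar_iff (isOpen_ker_comp_inclPlaceAdelic (cmDetChar L 2 (Matrix.of fun i j : Fin 2 => if i.val + j.val + 1 = 2 then (1 : L) else 0) (ξ.η * ξ.ψ) (isAutomorphic_eta_mul_psi ξ) (isUnit_antidiagOne_det L 2).ne_zero).toMonoidHom (cmDetChar L 2 (Matrix.of fun i j : Fin 2 => if i.val + j.val + 1 = 2 then (1 : L) else 0) (ξ.η * ξ.ψ) (isAutomorphic_eta_mul_psi ξ) (isUnit_antidiagOne_det L 2).ne_zero).continuous v)
        (isOpen_ker_comp_equiv (localPiEquiv L (IsCMField.complexConj L) 2 (Matrix.of fun i j : Fin 2 => if i.val + j.val + 1 = 2 then (1 : L) else 0) v) _ (isOpen_ker_xiLocalChar_comp_inl ξ v))).2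
      (xiLocalChar_comp_inl_comp_localPiEquiv ξ v).symm).trans
      (comap_mk_ofChar (localPiEquiv L (IsCMField.complexConj L) 2 (Matrix.of fun i j : Fin 2 => if i.val + j.val + 1 = 2 then (1 : L) else 0) v) ((ξ.xiLocalChar v).comp (MonoidHom.inl ((cmDatum L 2 (Matrix.of fun i j : Fin 2 => if i.val + j.val + 1 = 2 then (1 : L) else 0)).Local v) ((cmDatum L 1 (Matrix.of fun i j : Fin 1 => if i.val + j.val + 1 = 1 then (1 : L) else 0)).Local v))) (isOpen_ker_xiLocalChar_comp_inl ξ v) _).symm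
  rw [hcl]
  exact (IrrClass.comap_injective _).eq_iff

/-- **EXISTENCE ON `U(Φ₂)`, EXPLICIT**: the line of the unitary automorphic character `((η ψ) ∘ det)⁻¹` of `U(Φ₂)(𝔸)` (★ `DiscreteAutomorphicRep.ofChar`,
on which `R(g) = (η ψ)(det g)`) realises `ξ_v ∘ inl`. [cite: Rogawski1990, §13.3 pp. 202–203] -/
theorem realises₂_ofChar {μ₂ : Measure (adelicGroupData ↥(maximalRealSubfield L) L (IsCMField.complexConj L) 2 (Matrix.of fun i j : Fin 2 => if i.val + j.val + 1 = 2 then (1 : L) else 0)).automorphicQuotient} [(adelicGroupData ↥(maximalRealSubfield L) L (IsCMField.complexConj L) 2 (Matrix.of fun i j : Fin 2 => if i.val + j.val + 1 = 2 then (1 : L) else 0)).IsAutomorphicMeasure μ₂] (ξ : OneDimAutRepH L) :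
    Realises₂ (DiscreteAutomorphicRep.ofChar (cmDetChar L 2 (Matrix.of fun i j : Fin 2 => if i.val + j.val + 1 = 2 then (1 : L) else 0) (ξ.η * ξ.ψ) (isAutomorphic_eta_mul_psi ξ) (isUnit_antidiagOne_det L 2).ne_zero)⁻¹ μ₂) ξ := by
  refine realises₂_of_forall_apply_eq_smul _ ξ fun g f => ?_
  rw [DiscreteAutomorphicRep.ofChar_toContRep_apply, AdelicGroupData.AutomorphicCharacter.coe_inv_apply, inv_inv]

/-- **EXISTENCE ON `U(Φ₂)`**: some discrete automorphic representation of `U(Φ₂)` realises `ξ_v ∘ inl = (η_v ψ_v) ∘ det₀` — the `∃ P₂, Realises₂ P₂ ξ` premise of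
the leaf row (KD5-H♭) (its uniqueness twin is the PRINT letter O8b ★ `PKmultOneU2Shape`, strong approximation). [cite: Rogawski1990, §13.3 pp. 202–203] -/
theorem exists_realises₂ (μ₂ : Measure (adelicGroupData ↥(maximalRealSubfield L) L (IsCMField.complexConj L) 2 (Matrix.of fun i j : Fin 2 => if i.val + j.val + 1 = 2 then (1 : L) else 0)).automorphicQuotient) [(adelicGroupData ↥(maximalRealSubfield L) L (IsCMField.complexConj L) 2 (Matrix.of fun i j : Fin 2 => if i.val + j.val + 1 = 2 then (1 : L) else 0)).IsAutomorphicMeasure μ₂] (ξ : OneDimAutRepH L) :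
    ∃ P₂ : DiscreteAutomorphicRep (adelicGroupData ↥(maximalRealSubfield L) L (IsCMField.complexConj L) 2 (Matrix.of fun i j : Fin 2 => if i.val + j.val + 1 = 2 then (1 : L) else 0)) μ₂, Realises₂ P₂ ξ :=
  ⟨_, realises₂_ofChar ξ⟩

end Summit.HodgeConjecture.HodgeConjecture.Cruxes.H413.F0P3cPKtupleU1Line

end
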